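import Summits.Ventures.Crystal3D.Theorems.StickyWulffConstantGenericWallFloorBarlowMachineStep
import Summits.Ventures.Crystal3D.Theorems.StickyWulffConstantNoReconstructionGainBarlowGrainFilmCone
import Summits.Ventures.Crystal3D.Theorems.StickyWulffConstantGenericWallFloorStackWalkForcedChain
import Summits.Ventures.Crystal3D.Theorems.StickyWulffConstantGenericWallFloorWalkReach
import HarnessLib

/-!
# Line `TexShadow` (crux `TextureLiminf`, stmt-Ventures-19483) — COVERABLE-CLASS VOCABULARY: the up-presentation of a plate,
# Δ-steepness, and Barlow off-reach (cf-p1 ROUTE §86(77) BT, DECISION (xxxvii)(1); typed by 19480-p2 as F4's consumer)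

HONEST FRAMING. Part of the venture `Summits/Ventures/Crystal3D` (cell `crystal3d-full`), route `route-Ventures-StickyWulffConstant`,
crux `TextureLiminf` (stmt-Ventures-19483), registered line `TexShadow`.  Definitions plus their presentation lemmas; nothing is
claimed about the stubs.  Rung credit only; F-C1 not moved.

The walker-covered wall statement (F4: `barlow_lineCount_le_payers`, lane G) needs each plate PRESENTED with its layer index
increasing along the walk direction `e` (`e₃` for the bottom plate, `−e₃` for the top plate), the family slot of the Δ class steep,
and the two plates' reach sets off each other.  In EXACTLY the normal form F4 consumes:

* `upFrame L e` — `L` if `(L⁻¹e)₂ ≥ 0`, else `L ∘ basalMirror`; `upWord L σ e` — `σ`, resp. the reversed word `n ↦ −σ(−n−1)`;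
  `upFrame_axis_nonneg`, `isHaggSeq_upWord`, and the PRESENTATION LEMMA `stacking_upFrame : stacking (upFrame L e) s (upWord L σ e)
  = stacking L s σ` (same origin `s`; p639985's `basalMirror_barlowPos_eq_reverse`);
* `famSlot L e := best3 (⟪·, (upFrame L e)⁻¹ e⟫) upSlot₁ upSlot₂ upSlot₃` — the family slot (the machine's Δ step, `…BarlowMachineStep`);
* `DeltaSteep L e : Prop := ∃ v ∈ fccSlots, v₂ = √(2/3) ∧ √2/2 ≤ ⟪upFrame L e v, e⟫` (σ-free), with `famSlot_steep_of_deltaSteep`;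
* `BarlowOffReach L₁ s₁ σ₁ L₂ s₂ σ₂ : Prop` — O1 ∧ O2 ∧ O3: the reach set of the up-presented bottom plate over its chain frames
  (`reachSet`, `chainFrames e₃ … (famSlot L₁ e₃)`, origin `L₁'((haggLabel σ₁' 0)·w) + s₁`) misses the top stacking, symmetrically with
  `−e₃`, and the two reach sets are disjoint.  No walker-run data enters.
WHAT THIS IS NOT: no statement about the stubs; which pairs are off-reach is lane F/T analysis; F-C1 not moved.
-/

noncomputable section

open scoped InnerProductSpace

namespace Summit.Ventures.Crystal3D.Cruxes.TextureLiminf.TexShadow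

open Summit.Ventures.Crystal3D Summit.Ventures.Crystal3D.Theorems
open Literature.MathematicalPhysics.StatisticalMechanics (barlowPos barlowStacking constHagg basalMirror haggLabel barlowOffset
  IsHaggSeq)

/-! ## The up-presentation of a plate -/

/-- The frame presenting the plate `(L, σ)` with its layer index increasing along `e`: `L` itself if `(L⁻¹e)₂ ≥ 0`, else `L ∘ M`
(`M` the basal mirror). -/
def upFrame (L : E3 ≃ₗᵢ[ℝ] E3) (e : E3) : E3 ≃ₗᵢ[ℝ] E3 :=
  if 0 ≤ (L.symm e) 2 then L else basalMirror.trans L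

/-- The word of the up-presentation: `σ` itself, resp. the reversed word `n ↦ −σ(−n−1)`. -/
def upWord (L : E3 ≃ₗᵢ[ℝ] E3) (σ : ℤ → ℤ) (e : E3) : ℤ → ℤ :=
  if 0 ≤ (L.symm e) 2 then σ else fun n => -σ (-n - 1)

/-- The up-presentation's model axis points along `e`: `((upFrame L e)⁻¹ e)₂ ≥ 0`. -/
theorem upFrame_axis_nonneg (L : E3 ≃ₗᵢ[ℝ] E3) (e : E3) : 0 ≤ ((upFrame L e).symm e) 2 := by
  unfold upFrame
  split_ifs with h
  · exact h
  · rw [LinearIsometryEquiv.symm_trans, LinearIsometryEquiv.trans_apply]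
    show 0 ≤ (basalMirror.symm (L.symm e)) 2
    have hb : ∀ x : E3, basalMirror.symm x = basalMirror x := fun x =>
      calc basalMirror.symm x = basalMirror.symm (basalMirror (basalMirror x)) := by
            rw [Literature.MathematicalPhysics.StatisticalMechanics.basalMirror_basalMirror]
        _ = basalMirror x := basalMirror.symm_apply_apply _
    rw [hb, Literature.MathematicalPhysics.StatisticalMechanics.basalMirror_apply_coord]
    simp only [if_true]
    linarith

/-- The up-word is a Hägg word. -/
theorem isHaggSeq_upWord (L : E3 ≃ₗᵢ[ℝ] E3) {σ : ℤ → ℤ} (hσ : IsHaggSeq σ) (e : E3) : IsHaggSeq (upWord L σ e) := by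
  unfold upWord
  split_ifs
  · exact hσ
  · exact isHaggSeq_reverse hσ

/-- Reversing twice gives the word back. -/
theorem reverse_reverse (σ : ℤ → ℤ) : (fun n => -(fun n => -σ (-n - 1)) (-n - 1)) = σ := by
  funext n; simp only [neg_neg]; congr 1; ring

/-- **The presentation lemma**: the up-presentation describes the same plate with the same origin. -/
theorem stacking_upFrame (L : E3 ≃ₗᵢ[ℝ] E3) (s : E3) (σ : ℤ → ℤ) (e : E3) :
    stacking (upFrame L e) s (upWord L σ e) = stacking L s σ := by
  unfold upFrame upWord
  split_ifs with h
  · rfl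
  · ext q
    constructor
    · intro hq
      have h2 := reversed_grain_mem (σ := fun n => -σ (-n - 1)) (basalMirror.trans L) s q hq
      rw [reverse_reverse] at h2
      have htr : (basalMirror.trans (basalMirror.trans L) : E3 ≃ₗᵢ[ℝ] E3) = L := by
        ext x : 1
        simp only [LinearIsometryEquiv.trans_apply, Literature.MathematicalPhysics.StatisticalMechanics.basalMirror_basalMirror]
      have h3 : q ∈ (fun p => ((basalMirror.trans (basalMirror.trans L)) p + s)) '' barlowStacking 1 (Real.sqrt (2 / 3)) σ := h2
      rw [htr] at h3
      exact h3
    · intro hq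
      exact reversed_grain_mem L s q hq

/-! ## The family slot and Δ-steepness -/

/-- **The family slot** of the plate toward `e`: the best of the three reference upper slots of the up-presented frame
(= the walk machine's Δ step, `familySlot_spec`). -/
def famSlot (L : E3 ≃ₗᵢ[ℝ] E3) (e : E3) : E3 :=
  best3 (fun w => ⟪w, (upFrame L e).symm e⟫_ℝ) upSlot₁ upSlot₂ upSlot₃

/-- **Δ-STEEP toward `e`**: some upper slot of the up-presented frame rises by `≥ √2/2` along `e` (the launch condition of the
cap-started walkers, `walkInv_capStart_barlow` / `walkInv_capStart₂_barlow`; σ-free). -/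
def DeltaSteep (L : E3 ≃ₗᵢ[ℝ] E3) (e : E3) : Prop :=
  ∃ v ∈ fccSlots, v 2 = Real.sqrt (2 / 3) ∧ Real.sqrt 2 / 2 ≤ ⟪upFrame L e v, e⟫_ℝ

/-- The family slot is a reference upper slot. -/
theorem famSlot_mem (L : E3 ≃ₗᵢ[ℝ] E3) (e : E3) : famSlot L e ∈ fccSlots ∧ famSlot L e 2 = Real.sqrt (2 / 3) := by
  obtain ⟨h1, h2, h3⟩ := upSlots_mem_fccSlots
  unfold famSlot
  rcases best3_mem (fun w => ⟪w, (upFrame L e).symm e⟫_ℝ) upSlot₁ upSlot₂ upSlot₃ with h | h | h <;> rw [h]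
  · exact ⟨h1, by simp [upSlot₁, Literature.MathematicalPhysics.StatisticalMechanics.barlowPos_apply_two]⟩
  · exact ⟨h2, by simp [upSlot₂, Literature.MathematicalPhysics.StatisticalMechanics.barlowPos_apply_two]⟩
  · exact ⟨h3, by simp [upSlot₃, Literature.MathematicalPhysics.StatisticalMechanics.barlowPos_apply_two]⟩

/-- **Δ-steep ⇒ the family slot is steep.** -/
theorem famSlot_steep_of_deltaSteep (L : E3 ≃ₗᵢ[ℝ] E3) (e : E3) (h : DeltaSteep L e) :
    Real.sqrt 2 / 2 ≤ ⟪upFrame L e (famSlot L e), e⟫_ℝ := by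
  obtain ⟨v, hv, hv2, hsteep⟩ := h
  have hin : ∀ x : E3, ⟪upFrame L e x, e⟫_ℝ = ⟪x, (upFrame L e).symm e⟫_ℝ := fun x => by
    rw [← LinearIsometryEquiv.inner_map_map (upFrame L e) x ((upFrame L e).symm e), LinearIsometryEquiv.apply_symm_apply]
  rw [hin] at hsteep ⊢
  unfold famSlot
  rw [apply_best3 (fun w => ⟪w, (upFrame L e).symm e⟫_ℝ)]
  rcases eq_upSlot_of_apply_two hv hv2 with h | h | h <;> rw [h] at hsteep
  · exact hsteep.trans (le_max_of_le_left (le_max_left _ _))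
  · exact hsteep.trans (le_max_of_le_left (le_max_right _ _))
  · exact hsteep.trans (le_max_right _ _)

/-! ## Barlow off-reach -/

/-- **BARLOW OFF-REACH** for a facing pair of plates (bottom `(L₁, s₁, σ₁)` walked along `e₃`, top `(L₂, s₂, σ₂)` walked along `−e₃`,
both in their up-presentations `Lᵢ' = upFrame`, `σᵢ' = upWord`, family slots `vᵢ = famSlot`):
O1 — the reach set of plate 1 over its chain frames misses the top stacking; O2 — symmetrically; O3 — the two reach sets are
disjoint.  (`reachSet`, `chainFrames`: `…GenericWallFloorWalkReach`, `…StackWalkForcedChain`; origin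
`Lᵢ'((haggLabel σᵢ' 0)·w) + sᵢ` as in `barlow_mem_reachSet_chainFrames`.) -/
def BarlowOffReach (L₁ : E3 ≃ₗᵢ[ℝ] E3) (s₁ : E3) (σ₁ : ℤ → ℤ) (L₂ : E3 ≃ₗᵢ[ℝ] E3) (s₂ : E3) (σ₂ : ℤ → ℤ) : Prop :=
  (∀ y ∈ reachSet (upFrame L₁ e₃) (upFrame L₁ e₃ ((haggLabel (upWord L₁ σ₁ e₃) 0 : ℝ) • barlowOffset 1) + s₁)
      (chainFrames e₃ (upFrame L₁ e₃) (famSlot L₁ e₃)), y ∉ stacking L₂ s₂ σ₂) ∧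
  (∀ y ∈ reachSet (upFrame L₂ (-e₃)) (upFrame L₂ (-e₃) ((haggLabel (upWord L₂ σ₂ (-e₃)) 0 : ℝ) • barlowOffset 1) + s₂)
      (chainFrames (-e₃) (upFrame L₂ (-e₃)) (famSlot L₂ (-e₃))), y ∉ stacking L₁ s₁ σ₁) ∧
  (∀ y ∈ reachSet (upFrame L₁ e₃) (upFrame L₁ e₃ ((haggLabel (upWord L₁ σ₁ e₃) 0 : ℝ) • barlowOffset 1) + s₁)
      (chainFrames e₃ (upFrame L₁ e₃) (famSlot L₁ e₃)),
    y ∉ reachSet (upFrame L₂ (-e₃)) (upFrame L₂ (-e₃) ((haggLabel (upWord L₂ σ₂ (-e₃)) 0 : ℝ) • barlowOffset 1) + s₂)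
      (chainFrames (-e₃) (upFrame L₂ (-e₃)) (famSlot L₂ (-e₃))))

end Summit.Ventures.Crystal3D.Cruxes.TextureLiminf.TexShadow

end
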